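import Summits.NavierStokesRegularity.NavierStokesRegularity.Theorems.StretchingWellBindingEnstrophyQuarterLawDensitySieveSlice
import Literature.Analysis.FluidPDE.ElgindiBlowup
import HarnessLib

/-!
# Shelf crux `EnstrophyQuarterLaw` (stmt-NavierStokesRegularity-1574): the density-sieve slice bound on `ℝ³`
# — local enstrophy of ONE velocity slice from a weak-`L³` tail, a sup bound and slice ε-regularity

Helper file (`--supports stmt-NavierStokesRegularity-1574 --as helper`; def-free; seat leafhand-ns-efficiencyfloor-4
g10; specialises `…DensitySieveSlice` (p832280) to physical space). For a slice `v : ℝ³ → ℝ³` (standing for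
`u(t₀,·)` of a hypothetical first blow-up) with `vol{‖v‖ > ε/r} ≤ (M r/ε)³` for `0 < r ≤ r₀` (`‖v‖_{L^{3,w}} ≤ M`),
`‖v‖ ≤ U`, and the SLICE ε-REGULARITY hypothesis «not density-bad at `(x,r)` ⟹ `‖∇v(x)‖ ≤ C/r²`» (the form in
which a density-sieve line cites Choe–Wolf–Yang [cite: ChoeWolfYang2019, Thm 1, Lemma 8 (19), Lemma 9]), on every
measurable `A ⊆ ℝ³`:
* `setLIntegral_fderiv_sq_le_of_densitySieve`: `∫_A ‖∇v‖² ≤ (C²/r₀⁴)·vol A + 16 C² (8 v₁ M³/ε⁴)(1/r₀ + 2U/ε)`,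
* `setLIntegral_curl_sq_le_of_densitySieve`: the same for `∫_A |curl v|²` with an extra factor `16`
  (`|curl v| ≤ 4‖∇v‖`, `norm_curl_le_four_mul`),
where `v₁ = vol B(0,1)`. Read with `U = M₁ (T − t₀)^{-1/2}` (sup-rate Type I, stmt-0056) and `A = B(0,ρ)` this is the
NEAR-FIELD half of the quarter law `Z(t₀) ≤ K (T − t₀)^{-1/2}`; the far field is the landed `FarFieldEnstrophy`.

HONEST FRAMING: a theorem about one vector field; its three analytic inputs are HYPOTHESES (open / unformalised for
a first blow-up); no registered stub of line «sparse_sieve» is closed, the crux `EnstrophyQuarterLaw` stays OPEN and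
no summit statement is proved. [folklore]
-/

noncomputable section

-- the summit and its single sub-problem share the name (CONVENTIONS §1), as in every Theorems file
set_option linter.dupNamespace false

namespace Summit.NavierStokesRegularity.NavierStokesRegularity.Theorems.EnstrophyQuarterLaw.DensitySieve

open MeasureTheory Set Metric
open Literature.Analysis.FluidPDE
open scoped ENNReal

/-- Cubic growth of Lebesgue measure of balls in `ℝ³`: `vol B(x,s) ≤ v₁ s³` with `v₁ = vol B(0,1)` (in fact `=`).
[folklore] -/
theorem volume_ball_le_toReal_mul_cube (x : EuclideanSpace ℝ (Fin 3)) {s : ℝ} (hs : 0 < s) :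
    volume (Metric.ball x s) ≤
      ENNReal.ofReal ((volume (Metric.ball (0 : EuclideanSpace ℝ (Fin 3)) 1)).toReal * s ^ 3) := by
  have hfin : volume (Metric.ball (0 : EuclideanSpace ℝ (Fin 3)) 1) ≠ ∞ := measure_ball_lt_top.ne
  rw [Measure.addHaar_ball volume x hs.le, finrank_euclideanSpace, Fintype.card_fin,
    ENNReal.ofReal_mul ENNReal.toReal_nonneg, ENNReal.ofReal_toReal hfin, mul_comm]

/-- **Density-sieve bound for the local gradient energy of one slice on `ℝ³`.** [cite: ChoeWolfYang2019, Thm 1–2] -/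
theorem setLIntegral_fderiv_sq_le_of_densitySieve
    (v : EuclideanSpace ℝ (Fin 3) → EuclideanSpace ℝ (Fin 3)) {M ε C U r₀ : ℝ}
    (hM : 0 ≤ M) (hε : 0 < ε) (hU : 0 < U) (hr₀ : 0 < r₀)
    (htail : ∀ r ∈ Set.Ioc 0 r₀,
      volume {y | ε / r < ‖v y‖} ≤ ENNReal.ofReal ((M * r / ε) ^ 3))
    (hsup : ∀ y, ‖v y‖ ≤ U)
    (hreg : ∀ (x : EuclideanSpace ℝ (Fin 3)), ∀ r ∈ Set.Ioc 0 r₀,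
      ¬ (ENNReal.ofReal (ε * r ^ 3) ≤ volume ({y | ε / r < ‖v y‖} ∩ Metric.ball x r)) →
        ‖fderiv ℝ v x‖ ≤ C / r ^ 2)
    (A : Set (EuclideanSpace ℝ (Fin 3))) (hA : MeasurableSet A) :
    ∫⁻ x in A, ‖fderiv ℝ v x‖ₑ ^ 2 ≤
      ENNReal.ofReal (C ^ 2 / r₀ ^ 4) * volume A +
        ENNReal.ofReal (16 * C ^ 2 *
          (8 * (volume (Metric.ball (0 : EuclideanSpace ℝ (Fin 3)) 1)).toReal * M ^ 3 / ε ^ 4) *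
          (1 / r₀ + 2 * U / ε)) := by
  have h := setLIntegral_sq_le_of_densitySieve volume v (fun x => ‖fderiv ℝ v x‖) hM hε hU hr₀
    ENNReal.toReal_nonneg (fun x s hs => volume_ball_le_toReal_mul_cube x hs) htail hsup hreg
    (fun x => norm_nonneg _) A hA
  have hint : ∫⁻ x in A, ‖fderiv ℝ v x‖ₑ ^ 2 = ∫⁻ x in A, ENNReal.ofReal (‖fderiv ℝ v x‖ ^ 2) := by
    refine lintegral_congr fun x => ?_
    rw [← ofReal_norm, ENNReal.ofReal_pow (norm_nonneg _)]
  rw [hint]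
  exact h

/-- **Density-sieve bound for the local enstrophy of one slice on `ℝ³`** (`|curl v|² ≤ 16 ‖∇v‖²`).
[cite: ChoeWolfYang2019, Thm 1–2] -/
theorem setLIntegral_curl_sq_le_of_densitySieve
    (v : EuclideanSpace ℝ (Fin 3) → EuclideanSpace ℝ (Fin 3)) {M ε C U r₀ : ℝ}
    (hM : 0 ≤ M) (hε : 0 < ε) (hU : 0 < U) (hr₀ : 0 < r₀)
    (htail : ∀ r ∈ Set.Ioc 0 r₀,
      volume {y | ε / r < ‖v y‖} ≤ ENNReal.ofReal ((M * r / ε) ^ 3))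
    (hsup : ∀ y, ‖v y‖ ≤ U)
    (hreg : ∀ (x : EuclideanSpace ℝ (Fin 3)), ∀ r ∈ Set.Ioc 0 r₀,
      ¬ (ENNReal.ofReal (ε * r ^ 3) ≤ volume ({y | ε / r < ‖v y‖} ∩ Metric.ball x r)) →
        ‖fderiv ℝ v x‖ ≤ C / r ^ 2)
    (A : Set (EuclideanSpace ℝ (Fin 3))) (hA : MeasurableSet A) :
    ∫⁻ x in A, ‖curl v x‖ₑ ^ 2 ≤
      16 * (ENNReal.ofReal (C ^ 2 / r₀ ^ 4) * volume A +
        ENNReal.ofReal (16 * C ^ 2 *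
          (8 * (volume (Metric.ball (0 : EuclideanSpace ℝ (Fin 3)) 1)).toReal * M ^ 3 / ε ^ 4) *
          (1 / r₀ + 2 * U / ε))) := by
  have hpt : ∀ x, ‖curl v x‖ₑ ^ 2 ≤ 16 * ‖fderiv ℝ v x‖ₑ ^ 2 := by
    intro x
    rw [← ofReal_norm, ← ofReal_norm, ← ENNReal.ofReal_pow (norm_nonneg _),
      ← ENNReal.ofReal_pow (norm_nonneg _), show (16 : ℝ≥0∞) = ENNReal.ofReal 16 by norm_num,
      ← ENNReal.ofReal_mul (by norm_num)]
    apply ENNReal.ofReal_le_ofReal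
    have h4 := norm_curl_le_four_mul v x
    have h0 : 0 ≤ ‖curl v x‖ := norm_nonneg _
    nlinarith
  calc ∫⁻ x in A, ‖curl v x‖ₑ ^ 2 ≤ ∫⁻ x in A, 16 * ‖fderiv ℝ v x‖ₑ ^ 2 := lintegral_mono fun x => hpt x
    _ = 16 * ∫⁻ x in A, ‖fderiv ℝ v x‖ₑ ^ 2 := by
        rw [lintegral_const_mul' _ _ (by norm_num)]
    _ ≤ _ := by
        gcongr
        exact setLIntegral_fderiv_sq_le_of_densitySieve v hM hε hU hr₀ htail hsup hreg A hA

end Summit.NavierStokesRegularity.NavierStokesRegularity.Theorems.EnstrophyQuarterLaw.DensitySieve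

end
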